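import Literature.Topology.FourManifolds.ProjectiveTowers
import Literature.Topology.FourManifolds.Homogeneity
import Literature.Topology.FourManifolds.OrientationDiffeotopy
import Literature.Topology.FourManifolds.PalaisBallComplement
import Literature.Topology.FourManifolds.CerfGammaFourProofs
import Literature.Topology.FourManifolds.ConnectedSumProofs
import Literature.Topology.FourManifolds.OrientedConnectedSumTransportProofs
import Literature.Topology.FourManifolds.SphereSimplyConnected
import Literature.Topology.FourManifolds.HomotopyS4SimplyConnected
import Literature.Uncategorized.Crux
import Summits.SmoothPoincare4.SmoothPoincare4.Theorems.ZeroSurgeryExoticZseSVanishesOnPairsEmbedReduction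
import Summits.SmoothPoincare4.SmoothPoincare4.Theorems.ZeroSurgeryExoticZseSVanishesOnPairsEmbedDontDissolveDefs
import HarnessLib

/-!
# Line `embed-dont-dissolve` for crux `ZseSVanishesOnPairs` (stmt-SmoothPoincare4-0368): the bet is "pair spheres are tower summands"

Calibration of the registered bet `stub_puncturedPairSphereEmbeds` of the crux skeleton
`Cruxes/ZseSVanishesOnPairs/Lines/embed_dont_dissolve.lean` FROM ABOVE, kernel-checked and def-free over tree
vocabulary (`IsOrientedConnectedSum`, `IsProjectiveTower`):

* `exists_puncturedEmbedding_of_point` — the punctured-embedding property is INDEPENDENT OF THE PUNCTURE: if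
  `(X ∖ {q₀}, oX)` embeds smoothly and orientation-preservingly in `(P, oP)` then so does `(X ∖ {q}, oX)` for
  every `q` (homogeneity of connected manifolds by diffeotopies, `Diffeomorph.exists_isDiffeotopicToId_apply_eq`,
  which preserve every orientation, `Diffeomorph.IsDiffeotopicToId.isOrientationPreserving`).  So the `∀ q` in
  the registered bet is cosmetic: a prover may puncture where convenient (e.g. at the centre of the ball chart,
  where `X ∖ {q}` is the pair ball `(B⁴ ∖ νD) ∪ h_γ` with an open collar).
* `exists_puncturedEmbedding_of_isOrientedConnectedSum` — **a connected summand embeds punctured**: if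
  `(P, oP)` is an oriented connected sum `(X, oX) # (Q, oQ)` then `(X ∖ {q}, oX)` embeds orientation-preservingly
  in `(P, oP)` for every `q` (the gluing embedding `jA` of the relational connected sum, moved to `q`).
* `puncturedPairSpheresEmbed_of_towerSummands` — hence the bet, for an orientation `o` of `ℂℙ²`, FOLLOWS from:
  every Manolescu–Piccirillo pair sphere `(X, oX)` is an oriented connected summand of some `o`-tower
  (`IsOrientedConnectedSum oX oQ oP ∧ IsProjectiveTower o k P oP` for some closed oriented cofactor `(Q, oQ)`).
  With the STANDARD cofactor `Q = #ᵏ(ℂℙ², o)` this hypothesis is `r`-fold one-chirality DISSOLUTION of the pair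
  spheres — Manolescu–Marengon–Sarkar–Willis's Question 9.12, catalogued OPEN even for balanced-presentation
  spheres (`Literature.Barriers.SmoothPoincare4.GluckTwistsDissolve`, scope caveat (a)); the converse "punctured
  embedding ⇒ summand" holds on paper (the closed complement of the embedded `X ∖ B̊⁴` capped with a 4-ball,
  Cerf `Γ₄ = 0`), the cofactor then being a smooth manifold HOMEOMORPHIC to `#ᵏℂℙ²` (Donaldson + Freedman),
  so the bet for one sphere is dissolution modulo exotic smooth structures on `#ᵏℂℙ²` — of which none is known.
* `sVanishesOnPairs_of_towerEngine_of_towerSummands` — composed with the landed reduction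
  (`sVanishesOnPairs_of_towerEngine_of_puncturedPairSpheresEmbed`, p96114): ENGINE (MMSW Cor. 1.9, named fact)
  ∧ "pair spheres are one-chirality tower summands" ⇒ the crux `Literature.Uncategorized.SVanishesOnPairs`.

Together with the landed `Negative/EmbedBetPosition.lean` (`SmoothPoincare4 ⇒` bet) and `Negative/HeightZero.lean`
(height `0` of the bet ⟺ the kill switch), this brackets the bet between the catalogued open statements it was
designed to sit between.  No `sorry`, no new definition; nothing here closes the crux item.
-/

noncomputable section

set_option linter.dupNamespace false

open scoped Manifold ContDiff Topology
open Set Function ContinuousMap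
open Literature.Topology.FourManifolds

namespace Summit.SmoothPoincare4.SmoothPoincare4.Theorems.ZseSVanishesOnPairs

/-- **The punctured-embedding property does not depend on the puncture.**  If the punctured oriented
connected 4-manifold `(X ∖ {q₀}, oX)` embeds smoothly and orientation-preservingly in `(P, oP)`, then so does
`(X ∖ {q}, oX)` for every point `q`: a diffeomorphism of `X` diffeotopic to the identity carries `q` to `q₀`
(homogeneity, Hirsch Ch. 8 §3 Thm. 3.1 with `k = 0`), preserves `oX` (a diffeotopy cannot reverse an
orientation), and restricts to a diffeomorphism `X ∖ {q} ≃ X ∖ {q₀}` of the open submanifolds; precompose.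
[cite: HirschDT1976, Ch. 8 §3, Thm. 3.1 (k = 0)] -/
theorem exists_puncturedEmbedding_of_point {X : Type} [TopologicalSpace X] [T2Space X] [ConnectedSpace X]
    [ChartedSpace (EuclideanSpace ℝ (Fin 4)) X] [IsManifold (𝓡 4) ∞ X] (oX : SmoothOrientation (𝓡 4) X)
    {P : Type} [TopologicalSpace P] [ChartedSpace (EuclideanSpace ℝ (Fin 4)) P] [IsManifold (𝓡 4) ∞ P]
    (oP : SmoothOrientation (𝓡 4) P) {q₀ : X}
    (j₀ : ↥((⟨{q₀}ᶜ, isOpen_compl_singleton⟩ : TopologicalSpace.Opens X)) → P)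
    (hj₀ : Manifold.IsSmoothEmbedding (𝓡 4) (𝓡 4) ∞ j₀)
    (hj₀o : IsOrientationPreserving
      (oX.restrict (⟨{q₀}ᶜ, isOpen_compl_singleton⟩ : TopologicalSpace.Opens X)) oP j₀)
    (q : X) :
    ∃ j : ↥((⟨{q}ᶜ, isOpen_compl_singleton⟩ : TopologicalSpace.Opens X)) → P,
      Manifold.IsSmoothEmbedding (𝓡 4) (𝓡 4) ∞ j ∧
        IsOrientationPreserving (oX.restrict (⟨{q}ᶜ, isOpen_compl_singleton⟩ : TopologicalSpace.Opens X)) oP j := by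
  obtain ⟨φ, hφ, hφq⟩ := Diffeomorph.exists_isDiffeotopicToId_apply_eq_euclidean 4 X q q₀
  have hmem : ∀ x, x ∈ ((⟨{q}ᶜ, isOpen_compl_singleton⟩ : TopologicalSpace.Opens X)) ↔
      φ x ∈ ((⟨{q₀}ᶜ, isOpen_compl_singleton⟩ : TopologicalSpace.Opens X)) := fun x => by
    change x ∈ ({q}ᶜ : Set X) ↔ φ x ∈ ({q₀}ᶜ : Set X)
    rw [mem_compl_singleton_iff, mem_compl_singleton_iff, ← hφq]
    exact φ.injective.ne_iff.symm
  let Φ := opensCongr φ (⟨{q}ᶜ, isOpen_compl_singleton⟩ : TopologicalSpace.Opens X)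
    (⟨{q₀}ᶜ, isOpen_compl_singleton⟩ : TopologicalSpace.Opens X) hmem
  have hφo : IsOrientationPreserving oX oX φ := hφ.isOrientationPreserving oX
  have hΦo : IsOrientationPreserving (oX.restrict (⟨{q}ᶜ, isOpen_compl_singleton⟩ : TopologicalSpace.Opens X))
      (oX.restrict (⟨{q₀}ᶜ, isOpen_compl_singleton⟩ : TopologicalSpace.Opens X)) Φ :=
    hφo.opensRestrict (φ.mdifferentiable (by simp)) (fun _ => rfl)
  have hopen : IsOpen (range j₀) :=
    isOpen_range_of_isImmersion_of_finrank_le hj₀.isImmersion le_rfl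
  refine ⟨j₀ ∘ Φ, hj₀.comp_diffeomorph Φ, ?_⟩
  exact IsOrientationPreserving.comp_holds hj₀o hΦo (hj₀.contMDiff.mdifferentiable (by simp))
    (Φ.mdifferentiable (by simp)) (det_mfderiv_ne_zero_of_isSmoothEmbedding hj₀ hopen)
    (fun x => Φ.det_mfderiv_ne_zero (by simp) x)

/-- **A connected summand embeds punctured, at any point.**  If the oriented 4-manifold `(P, oP)` is an
oriented connected sum `(X, oX) # (Q, oQ)` (`IsOrientedConnectedSum`, Kervaire–Milnor's relational form) and
`X` is connected, then for every `q` the punctured `(X ∖ {q}, oX)` embeds smoothly and orientation-preservingly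
in `(P, oP)`: the relational sum provides such an embedding of `X ∖ {i₁ 0}` (its gluing map `jA`), and
`exists_puncturedEmbedding_of_point` moves the puncture. [cite: KervaireMilnor1963, §2] -/
theorem exists_puncturedEmbedding_of_isOrientedConnectedSum {X : Type} [TopologicalSpace X] [T2Space X]
    [ConnectedSpace X] [ChartedSpace (EuclideanSpace ℝ (Fin 4)) X] [IsManifold (𝓡 4) ∞ X] (oX : SmoothOrientation (𝓡 4) X)
    {Q : Type} [TopologicalSpace Q] [T2Space Q] [ChartedSpace (EuclideanSpace ℝ (Fin 4)) Q] [IsManifold (𝓡 4) ∞ Q]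
    (oQ : SmoothOrientation (𝓡 4) Q)
    {P : Type} [TopologicalSpace P] [ChartedSpace (EuclideanSpace ℝ (Fin 4)) P] [IsManifold (𝓡 4) ∞ P]
    (oP : SmoothOrientation (𝓡 4) P) (h : IsOrientedConnectedSum oX oQ oP) (q : X) :
    ∃ j : ↥((⟨{q}ᶜ, isOpen_compl_singleton⟩ : TopologicalSpace.Opens X)) → P,
      Manifold.IsSmoothEmbedding (𝓡 4) (𝓡 4) ∞ j ∧
        IsOrientationPreserving (oX.restrict (⟨{q}ᶜ, isOpen_compl_singleton⟩ : TopologicalSpace.Opens X)) oP j := by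
  obtain ⟨i₁, i₂, o₀, jA, jB, hi₁, hi₂, ho₁, ho₂, ⟨hA, hAo, hB, hBo, hU, hR⟩, hjA, hjB⟩ := h
  exact exists_puncturedEmbedding_of_point oX oP jA hA hjA q

/-- A closed smooth 4-manifold homotopy equivalent to `S⁴` is connected (it is simply connected:
`π₁(S⁴) = 1` transported along the homotopy equivalence). [cite: HatcherAT2002, Prop. 1.14] -/
theorem connectedSpace_of_homotopyEquiv_sphere_four {X : Type} [TopologicalSpace X] (e : X ≃ₕ (Metric.sphere (0 : EuclideanSpace ℝ (Fin 5)) 1)) :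
    ConnectedSpace X := by
  haveI : SimplyConnectedSpace X :=
    simplyConnectedSpace_of_homotopyEquiv_sphere_four simplyConnectedSpace_sphere_four_holds X e
  infer_instance

/-- **The bet follows from "pair spheres are one-chirality tower summands".**  Fix an orientation `o` of
`ℂℙ²`.  If for every Manolescu–Piccirillo pair-sphere datum `(g, X, e, f, j, oX)` — slice disc `g` of `K`, closed
smooth `X ≃ₕ S⁴` with slice data `(e, f)` for `K'`, the open slice-disc exterior embedded by `j` onto
`X ∖ (e(𝔻⁴) ∪ f(𝔻²))`, `oX` making the ball chart orientation preserving — the oriented manifold `(X, oX)` is an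
oriented connected summand of SOME `o`-tower `(P, oP) = (X, oX) # (Q, oQ)`, `IsProjectiveTower o k P oP` (with
the standard cofactor `Q = #ᵏ(ℂℙ², o)` this is `k`-fold one-chirality DISSOLUTION of `X`, MMSW Question 9.12),
then the registered bet of line `embed-dont-dissolve` holds for `o`: every such punctured `(X ∖ {q}, oX)` embeds
orientation-preservingly in an `o`-tower.  "Embed, don't dissolve" is thus dissolution up to the cofactor.
[cite: ManolescuMarengonSarkarWillis2023, §9.3 and Question 9.12] [cite: KervaireMilnor1963, §2] -/
theorem puncturedPairSpheresEmbed_of_towerSummands (o : SmoothOrientation (𝓡 4) ComplexProjectivePlane)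
    (hsum : ∀ (K K' : Knot) (g : EuclideanSpace ℝ (Fin 2) → EuclideanSpace ℝ (Fin 4)) (X : Type) [TopologicalSpace X]
      [T2Space X] [SecondCountableTopology X] [ChartedSpace (EuclideanSpace ℝ (Fin 4)) X] [IsManifold (𝓡 4) ∞ X] [CompactSpace X]
      (e : EuclideanSpace ℝ (Fin 4) → X) (f : EuclideanSpace ℝ (Fin 2) → X) (j : sliceDiscExterior g → X) (oX : SmoothOrientation (𝓡 4) X),
      Nonempty (X ≃ₕ (Metric.sphere (0 : EuclideanSpace ℝ (Fin 5)) 1)) → K.IsSliceDisc g → K'.IsSliceDiscIn X e f →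
      Manifold.IsSmoothEmbedding (𝓡 4) (𝓡 4) ∞ j →
      range j = (e '' Metric.closedBall (0 : EuclideanSpace ℝ (Fin 4)) 1 ∪ f '' Metric.closedBall (0 : EuclideanSpace ℝ (Fin 2)) 1)ᶜ →
      IsOrientationPreserving (SmoothOrientation.euclidean 4) oX e →
      ∃ (Q : Type) (_ : TopologicalSpace Q) (_ : T2Space Q) (_ : SecondCountableTopology Q)
        (_ : ChartedSpace (EuclideanSpace ℝ (Fin 4)) Q) (_ : IsManifold (𝓡 4) ∞ Q) (_ : CompactSpace Q) (oQ : SmoothOrientation (𝓡 4) Q)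
        (k : ℕ) (P : Type) (_ : TopologicalSpace P) (_ : T2Space P) (_ : SecondCountableTopology P)
        (_ : ChartedSpace (EuclideanSpace ℝ (Fin 4)) P) (_ : IsManifold (𝓡 4) ∞ P) (_ : CompactSpace P) (oP : SmoothOrientation (𝓡 4) P),
        IsOrientedConnectedSum oX oQ oP ∧ IsProjectiveTower o k P oP) :
    ∀ (K K' : Knot) (g : EuclideanSpace ℝ (Fin 2) → EuclideanSpace ℝ (Fin 4)) (X : Type) [TopologicalSpace X]
      [T2Space X] [SecondCountableTopology X] [ChartedSpace (EuclideanSpace ℝ (Fin 4)) X] [IsManifold (𝓡 4) ∞ X] [CompactSpace X]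
      (e : EuclideanSpace ℝ (Fin 4) → X) (f : EuclideanSpace ℝ (Fin 2) → X) (j : sliceDiscExterior g → X) (oX : SmoothOrientation (𝓡 4) X) (q : X),
      Nonempty (X ≃ₕ (Metric.sphere (0 : EuclideanSpace ℝ (Fin 5)) 1)) → K.IsSliceDisc g → K'.IsSliceDiscIn X e f →
      Manifold.IsSmoothEmbedding (𝓡 4) (𝓡 4) ∞ j →
      range j = (e '' Metric.closedBall (0 : EuclideanSpace ℝ (Fin 4)) 1 ∪ f '' Metric.closedBall (0 : EuclideanSpace ℝ (Fin 2)) 1)ᶜ →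
      IsOrientationPreserving (SmoothOrientation.euclidean 4) oX e →
      ∃ (t : ℕ) (P : Type) (_ : TopologicalSpace P) (_ : T2Space P) (_ : SecondCountableTopology P)
        (_ : ChartedSpace (EuclideanSpace ℝ (Fin 4)) P) (_ : IsManifold (𝓡 4) ∞ P) (_ : CompactSpace P)
        (oP : SmoothOrientation (𝓡 4) P) (jP : ↥((⟨{q}ᶜ, isOpen_compl_singleton⟩ : TopologicalSpace.Opens X)) → P),
        IsProjectiveTower o t P oP ∧ Manifold.IsSmoothEmbedding (𝓡 4) (𝓡 4) ∞ jP ∧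
          IsOrientationPreserving (oX.restrict (⟨{q}ᶜ, isOpen_compl_singleton⟩ : TopologicalSpace.Opens X)) oP jP := by
  intro K K' g X _ _ _ _ _ _ e f j oX q hX hg hef hj hrange he
  obtain ⟨Q, _, _, _, _, _, _, oQ, k, P, _, _, _, _, _, _, oP, hsumX, hP⟩ :=
    hsum K K' g X e f j oX hX hg hef hj hrange he
  haveI : ConnectedSpace X := connectedSpace_of_homotopyEquiv_sphere_four hX.some
  obtain ⟨jP, hjP, hjPo⟩ := exists_puncturedEmbedding_of_isOrientedConnectedSum oX oQ oP hsumX q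
  exact ⟨k, P, _, ‹_›, ‹_›, _, ‹_›, ‹_›, oP, jP, hP, hjP, hjPo⟩

/-- **ENGINE ∧ "pair spheres are one-chirality tower summands" ⇒ CRUX** (line `embed-dont-dissolve`, composed
with the landed reduction `sVanishesOnPairs_of_towerEngine_of_puncturedPairSpheresEmbed`).  Hypotheses: the
named fact `Knot.rasmussen_nonpos_of_isTowerSlice` (MMSW 2023 Cor. 1.9, knot case) and, for SOME orientation
`o` of `ℂℙ²`, the summand property of every Manolescu–Piccirillo pair sphere.  In words: if the homotopy
4-spheres of `0`-surgery pairs with a slice member dissolve — up to an arbitrary closed cofactor — in projective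
towers of one chirality, then Rasmussen's `s` vanishes on every partner, i.e. crux #2 of route
`ZeroSurgeryExotic` is dead.  The conclusion is the crux under its tree name; nothing is closed by this theorem.
[cite: ManolescuMarengonSarkarWillis2023, Cor. 1.9, §9.3, Questions 9.11 and 9.12] -/
theorem sVanishesOnPairs_of_towerEngine_of_towerSummands
    (hengine : Knot.rasmussen_nonpos_of_isTowerSlice)
    (hsum : ∃ o : SmoothOrientation (𝓡 4) ComplexProjectivePlane,
      ∀ (K K' : Knot) (g : EuclideanSpace ℝ (Fin 2) → EuclideanSpace ℝ (Fin 4)) (X : Type) [TopologicalSpace X]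
      [T2Space X] [SecondCountableTopology X] [ChartedSpace (EuclideanSpace ℝ (Fin 4)) X] [IsManifold (𝓡 4) ∞ X] [CompactSpace X]
      (e : EuclideanSpace ℝ (Fin 4) → X) (f : EuclideanSpace ℝ (Fin 2) → X) (j : sliceDiscExterior g → X) (oX : SmoothOrientation (𝓡 4) X),
      Nonempty (X ≃ₕ (Metric.sphere (0 : EuclideanSpace ℝ (Fin 5)) 1)) → K.IsSliceDisc g → K'.IsSliceDiscIn X e f →
      Manifold.IsSmoothEmbedding (𝓡 4) (𝓡 4) ∞ j →
      range j = (e '' Metric.closedBall (0 : EuclideanSpace ℝ (Fin 4)) 1 ∪ f '' Metric.closedBall (0 : EuclideanSpace ℝ (Fin 2)) 1)ᶜ →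
      IsOrientationPreserving (SmoothOrientation.euclidean 4) oX e →
      ∃ (Q : Type) (_ : TopologicalSpace Q) (_ : T2Space Q) (_ : SecondCountableTopology Q)
        (_ : ChartedSpace (EuclideanSpace ℝ (Fin 4)) Q) (_ : IsManifold (𝓡 4) ∞ Q) (_ : CompactSpace Q) (oQ : SmoothOrientation (𝓡 4) Q)
        (k : ℕ) (P : Type) (_ : TopologicalSpace P) (_ : T2Space P) (_ : SecondCountableTopology P)
        (_ : ChartedSpace (EuclideanSpace ℝ (Fin 4)) P) (_ : IsManifold (𝓡 4) ∞ P) (_ : CompactSpace P) (oP : SmoothOrientation (𝓡 4) P),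
        IsOrientedConnectedSum oX oQ oP ∧ IsProjectiveTower o k P oP) :
    Literature.Uncategorized.SVanishesOnPairs := by
  obtain ⟨o, ho⟩ := hsum
  exact sVanishesOnPairs_of_towerEngine_of_puncturedPairSpheresEmbed hengine
    ⟨o, puncturedPairSpheresEmbed_of_towerSummands o ho⟩

/-! ### Appendix (same seat): the calibration against the line's NAMED bet `PuncturedPairSpheresEmbedIn o` -/

/-- **"Pair spheres are `o`-tower summands" ⇒ the named bet `PuncturedPairSpheresEmbedIn o`** of the line's Defs file
(`ZeroSurgeryExoticZseSVanishesOnPairsEmbedDontDissolveDefs.lean`, parallel seat): the named bet differs from the conclusion of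
`puncturedPairSpheresEmbed_of_towerSummands` only by two extra hypotheses placing the puncture `q` off the slice data, which are
simply discarded (punctured embeddability does not depend on the puncture, `exists_puncturedEmbedding_of_point`).
[cite: ManolescuMarengonSarkarWillis2023, §9.3 and Question 9.12] -/
theorem puncturedPairSpheresEmbedIn_of_towerSummands (o : SmoothOrientation (𝓡 4) ComplexProjectivePlane)
    (hsum : ∀ (K K' : Knot) (g : EuclideanSpace ℝ (Fin 2) → EuclideanSpace ℝ (Fin 4)) (X : Type) [TopologicalSpace X]
      [T2Space X] [SecondCountableTopology X] [ChartedSpace (EuclideanSpace ℝ (Fin 4)) X] [IsManifold (𝓡 4) ∞ X] [CompactSpace X]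
      (e : EuclideanSpace ℝ (Fin 4) → X) (f : EuclideanSpace ℝ (Fin 2) → X) (j : sliceDiscExterior g → X) (oX : SmoothOrientation (𝓡 4) X),
      Nonempty (X ≃ₕ (Metric.sphere (0 : EuclideanSpace ℝ (Fin 5)) 1)) → K.IsSliceDisc g → K'.IsSliceDiscIn X e f →
      Manifold.IsSmoothEmbedding (𝓡 4) (𝓡 4) ∞ j →
      range j = (e '' Metric.closedBall (0 : EuclideanSpace ℝ (Fin 4)) 1 ∪ f '' Metric.closedBall (0 : EuclideanSpace ℝ (Fin 2)) 1)ᶜ →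
      IsOrientationPreserving (SmoothOrientation.euclidean 4) oX e →
      ∃ (Q : Type) (_ : TopologicalSpace Q) (_ : T2Space Q) (_ : SecondCountableTopology Q)
        (_ : ChartedSpace (EuclideanSpace ℝ (Fin 4)) Q) (_ : IsManifold (𝓡 4) ∞ Q) (_ : CompactSpace Q) (oQ : SmoothOrientation (𝓡 4) Q)
        (k : ℕ) (P : Type) (_ : TopologicalSpace P) (_ : T2Space P) (_ : SecondCountableTopology P)
        (_ : ChartedSpace (EuclideanSpace ℝ (Fin 4)) P) (_ : IsManifold (𝓡 4) ∞ P) (_ : CompactSpace P) (oP : SmoothOrientation (𝓡 4) P),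
        IsOrientedConnectedSum oX oQ oP ∧ IsProjectiveTower o k P oP) :
    PuncturedPairSpheresEmbedIn o :=
  fun K K' g X _ _ _ _ _ _ e f j oX q hX hg hef hj hrange he _ _ =>
    puncturedPairSpheresEmbed_of_towerSummands o hsum K K' g X e f j oX q hX hg hef hj hrange he

/-- **ENGINE ∧ summands ⇒ CRUX, through the named bet** (the same composite as
`sVanishesOnPairs_of_towerEngine_of_towerSummands`, routed through `PuncturedPairSpheresEmbedIn` and the parallel seat's
reduction `sVanishesOnPairs_of_towerEngine_of_exists_puncturedPairSpheresEmbedIn`).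
[cite: ManolescuMarengonSarkarWillis2023, Cor. 1.9 and Question 9.12] -/
theorem sVanishesOnPairs_of_towerEngine_of_towerSummands'
    (hengine : Knot.rasmussen_nonpos_of_isTowerSlice)
    (hsum : ∃ o : SmoothOrientation (𝓡 4) ComplexProjectivePlane,
      ∀ (K K' : Knot) (g : EuclideanSpace ℝ (Fin 2) → EuclideanSpace ℝ (Fin 4)) (X : Type) [TopologicalSpace X]
      [T2Space X] [SecondCountableTopology X] [ChartedSpace (EuclideanSpace ℝ (Fin 4)) X] [IsManifold (𝓡 4) ∞ X] [CompactSpace X]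
      (e : EuclideanSpace ℝ (Fin 4) → X) (f : EuclideanSpace ℝ (Fin 2) → X) (j : sliceDiscExterior g → X) (oX : SmoothOrientation (𝓡 4) X),
      Nonempty (X ≃ₕ (Metric.sphere (0 : EuclideanSpace ℝ (Fin 5)) 1)) → K.IsSliceDisc g → K'.IsSliceDiscIn X e f →
      Manifold.IsSmoothEmbedding (𝓡 4) (𝓡 4) ∞ j →
      range j = (e '' Metric.closedBall (0 : EuclideanSpace ℝ (Fin 4)) 1 ∪ f '' Metric.closedBall (0 : EuclideanSpace ℝ (Fin 2)) 1)ᶜ →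
      IsOrientationPreserving (SmoothOrientation.euclidean 4) oX e →
      ∃ (Q : Type) (_ : TopologicalSpace Q) (_ : T2Space Q) (_ : SecondCountableTopology Q)
        (_ : ChartedSpace (EuclideanSpace ℝ (Fin 4)) Q) (_ : IsManifold (𝓡 4) ∞ Q) (_ : CompactSpace Q) (oQ : SmoothOrientation (𝓡 4) Q)
        (k : ℕ) (P : Type) (_ : TopologicalSpace P) (_ : T2Space P) (_ : SecondCountableTopology P)
        (_ : ChartedSpace (EuclideanSpace ℝ (Fin 4)) P) (_ : IsManifold (𝓡 4) ∞ P) (_ : CompactSpace P) (oP : SmoothOrientation (𝓡 4) P),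
        IsOrientedConnectedSum oX oQ oP ∧ IsProjectiveTower o k P oP) :
    Literature.Uncategorized.SVanishesOnPairs := by
  obtain ⟨o, ho⟩ := hsum
  exact sVanishesOnPairs_of_towerEngine_of_exists_puncturedPairSpheresEmbedIn hengine
    ⟨o, puncturedPairSpheresEmbedIn_of_towerSummands o ho⟩

end Summit.SmoothPoincare4.SmoothPoincare4.Theorems.ZseSVanishesOnPairs

end
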